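import Literature.Barriers.FinalStateConjecture.ExtremalHorizonSlabILED
import HarnessLib

/-!
# Barrier catalogue `FinalStateConjecture`: Aretakis's pointwise horizon decay on extremal Kerr
# (JFA 2012, Thm. 5) — the discharge `Aretakis2012_pointwiseDecay_holds`
# (`Literature/Barriers/FinalStateConjecture/`, D-0021, D-0014; family `gr`)

The named fact `Literature.Barriers.FinalStateConjecture.Aretakis2012_pointwiseDecay`
(`ExtremalHorizonAxisymmetricDecay.lean`; S. Aretakis, J. Funct. Anal. 263 (2012) 2770–2831, Thm. 5:
axisymmetric solutions of `□_{g_{M,M}}ψ = 0` on extremal Kerr with smooth compactly supported data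
decay pointwise along the future event horizon) is PROVED here, by composing

* `Aretakis2012_pointwiseDecay_of_slabILED` (`ExtremalHorizonPointwiseDecayFromILED.lean`): the
  catalogue's proof of §§4, 5, 7, 13, 15 of the source — Thm. 5 follows from Thm. 2 (uniform
  boundedness of the non-degenerate energy near `𝓗⁺`, by the degenerate red-shift current of §13)
  and from the integrated local energy decay statement of Thm. 1 restricted to the compact transition
  slab `{23M/21 ≤ r ≤ 8M/7}`, via the `T`-commutation, the `L²(S_τ)` decay of the shells, the Carter
  operator and the spherical Sobolev inequality of §15;
* `slabILED_holds` (`ExtremalHorizonSlabILED.lean`): that integrated local energy decay statement for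
  the class, proved by the physical-space Morawetz current of `KerrStarMorawetzPositivity.lean`
  (after Giorgi–Wan, JFA 287 (2024) 110668, with a seed regular across `𝓗⁺` and exact positivity
  certificates) — in place of the frequency-localised currents of §§8–12 of the source.

No named facts are used (D-0026).

## References

* S. Aretakis, *Decay of axisymmetric solutions of the wave equation on extreme Kerr backgrounds*,
  J. Funct. Anal. 263 (2012) 2770–2831 (arXiv:1110.2006): Thm. 1, Thm. 2, Thm. 5, §§13, 15
  (key `Aretakis2012`).
* E. Giorgi, J. Wan, *Physical-space estimates for axisymmetric waves on extremal Kerr spacetime*,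
  J. Funct. Anal. 287 (2024) 110668 (arXiv:2212.13164): Thm. 1.1, Cor. 1.2 (key `GiorgiWan2024`).
-/

noncomputable section

namespace Literature.Barriers.FinalStateConjecture

/-- **Aretakis 2012, Thm. 5 (pointwise decay of axisymmetric waves along the extremal Kerr horizon)
holds**: the named fact `Aretakis2012_pointwiseDecay` is a theorem — integrated local energy decay on
the transition slab (`slabILED_holds`, physical-space Morawetz current) fed into the catalogue's
reduction `Aretakis2012_pointwiseDecay_of_slabILED` (§§13, 15 of the source).
[cite: Aretakis2012, Thm. 5; GiorgiWan2024, Cor. 1.2] -/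
theorem Aretakis2012_pointwiseDecay_holds : Aretakis2012_pointwiseDecay :=
  Aretakis2012_pointwiseDecay_of_slabILED slabILED_holds

end Literature.Barriers.FinalStateConjecture

end
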